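import Literature.NumberTheory.LFunctions.DirichletPolynomialGallagher
import Literature.NumberTheory.LFunctions.PoissonSmoothing
import Mathlib.Analysis.SumIntegralComparisons
import HarnessLib

/-!
# The mean value of a Dirichlet polynomial against the Cauchy kernel (Conrey–Iwaniec 2002, (5.15))

B. Conrey, H. Iwaniec, *Spacing of zeros of Hecke L-functions and the class number problem*,
Acta Arith. 103 (2002), §5 [held text `paper:arxiv-math_0111012`, p0014 L1–20].

For a finite Dirichlet polynomial `D(τ) = Σ_{n ≤ N} a_n n^{−iτ}` (`dpoly`) and `T ≥ 2`:
`∫_ℝ |D(τ)|² (1 + τ²/T²)^{−1} dτ ≤ π Σ_n (T + 3n)|a_n|²` (`integral_norm_sq_dpoly_cauchy_le`), via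
the Poisson kernel identity `∫ e^{−iτv}(1+τ²/T²)^{−1}dτ = πT e^{−T|v|}` (tree
`PoissonSmoothing.integral_kernel_mul_exp`), `|Σ_{m,n} a_m ā_n K_{mn}| ≤ Σ_n |a_n|² Σ_m K_{mn}` for
the symmetric kernel `K_{mn} = min(m/n, n/m)^T`, and the row sums
`Σ_m min(m/n,n/m)^T ≤ 1 + n/(T+1) + n/(T−1) ≤ 1 + 3n/T` (sum–integral comparison). This is the
error-term engine of the weighted discrete mean values (Lemma 5.3 / Proposition 5.4) in
`WeightedDiscreteMeanValue.lean`. Everything PROVED; no definition besides the abbreviation `dpoly`.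

«The programme SEARCHES and TYPES; no claim about Landau–Siegel zeros until a kernel theorem says so.»

## References
* [ConreyIwaniec2002] B. Conrey, H. Iwaniec, Acta Arith. 103 (2002) 259–312, arXiv:math/0111012:
  §5, Lemma 5.1 (5.3)–(5.4), Corollary 5.2 (5.5), (5.10)–(5.16), Lemma 5.3 (5.17),
  Proposition 5.4 (5.18)–(5.19).
-/

noncomputable section

open Complex MeasureTheory Filter Set Finset Real FourierTransform
open scoped Topology Real

namespace Literature.NumberTheory.LFunctions

namespace WeightedMeanValue

open Gallagher (phase norm_phase continuous_phase natCast_cpow_eq_phase)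

/-! ## §1. The Dirichlet polynomial and the Cauchy-kernel mean value (5.15) -/

/-- The Dirichlet polynomial `D(τ) = Σ_{n=1}^{N} a_n n^{−iτ}` is continuous in `τ`.
[cite: ConreyIwaniec2002, §5 (5.1)] -/
theorem continuous_dpoly (a : ℕ → ℂ) (N : ℕ) :
    Continuous fun τ : ℝ => ∑ n ∈ Finset.Icc 1 N, a n * (n : ℂ) ^ (-((τ : ℂ) * I)) := by
  have : (fun τ : ℝ => ∑ n ∈ Finset.Icc 1 N, a n * (n : ℂ) ^ (-((τ : ℂ) * I))) =
      fun τ => ∑ n ∈ Finset.Icc 1 N, a n * phase n τ :=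
    funext (Gallagher.dirichletPolynomial_eq_sum_phase a N)
  rw [this]
  exact continuous_finsetSum _ fun n _ => continuous_const.mul (continuous_phase n)

/-- `|D(τ)| ≤ Σ |a_n|` for the Dirichlet polynomial `D(τ) = Σ_{n=1}^{N} a_n n^{−iτ}`.
[cite: ConreyIwaniec2002, §5 (5.1)] -/
theorem norm_dpoly_le (a : ℕ → ℂ) (N : ℕ) (τ : ℝ) :
    ‖∑ n ∈ Finset.Icc 1 N, a n * (n : ℂ) ^ (-((τ : ℂ) * I))‖ ≤ ∑ n ∈ Finset.Icc 1 N, ‖a n‖ := by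
  rw [Gallagher.dirichletPolynomial_eq_sum_phase]
  refine (norm_sum_le _ _).trans (Finset.sum_le_sum fun n _ => ?_)
  rw [norm_mul, norm_phase, mul_one]

/-- `|D(τ)|² = Re Σ_{m,n} a_m ā_n e^{−iτ(log m − log n)}` — the expansion behind (5.15).
[cite: ConreyIwaniec2002, §5 (display after (5.13))] -/
theorem norm_sq_dpoly_eq (a : ℕ → ℂ) (N : ℕ) (τ : ℝ) :
    ‖∑ n ∈ Finset.Icc 1 N, a n * (n : ℂ) ^ (-((τ : ℂ) * I))‖ ^ 2 =
      (∑ m ∈ Finset.Icc 1 N, ∑ n ∈ Finset.Icc 1 N, a m * starRingEnd ℂ (a n) *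
        Complex.exp (-((τ * (Real.log m - Real.log n) : ℝ) : ℂ) * I)).re := by
  rw [Gallagher.dirichletPolynomial_eq_sum_phase]
  set S := ∑ n ∈ Finset.Icc 1 N, a n * phase n τ with hS
  have h1 : ‖S‖ ^ 2 = (S * starRingEnd ℂ S).re := by
    rw [Complex.mul_conj', ← Complex.ofReal_pow, Complex.ofReal_re]
  rw [h1, hS, map_sum, Finset.sum_mul_sum]
  congr 1
  refine Finset.sum_congr rfl fun m _ => Finset.sum_congr rfl fun n _ => ?_
  have hconj : starRingEnd ℂ (phase n τ) = Complex.exp (((τ * Real.log n : ℝ) : ℂ) * I) := by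
    rw [phase, ← Complex.exp_conj, map_mul, Complex.conj_ofReal, Complex.conj_I]
    congr 1; push_cast; ring
  rw [map_mul, hconj, phase]
  have : Complex.exp (((-(τ * Real.log m) : ℝ) : ℂ) * I) * Complex.exp (((τ * Real.log n : ℝ) : ℂ) * I)
      = Complex.exp (-((τ * (Real.log m - Real.log n) : ℝ) : ℂ) * I) := by
    rw [← Complex.exp_add]; congr 1; push_cast; ring
  rw [← this]; ring

/-- **The Poisson kernel integral**: `∫ e^{−iτv} (1 + τ²/T²)^{−1} dτ = πT e^{−T|v|}` (`T > 0`).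
[cite: ConreyIwaniec2002, §5 (display after (5.13))] -/
theorem integral_exp_mul_cauchy {T : ℝ} (hT : 0 < T) (v : ℝ) :
    ∫ τ : ℝ, Complex.exp (-((τ * v : ℝ) : ℂ) * I) * (((1 + τ ^ 2 / T ^ 2)⁻¹ : ℝ) : ℂ) =
      ((π * T * Real.exp (-(T * |v|)) : ℝ) : ℂ) := by
  have h := PoissonSmoothing.integral_kernel_mul_exp hT v
  have hker : ∀ τ : ℝ, (PoissonSmoothing.kernel T τ : ℂ) =
      ((1 / (π * T) : ℝ) : ℂ) * (((1 + τ ^ 2 / T ^ 2)⁻¹ : ℝ) : ℂ) := by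
    intro τ
    rw [← Complex.ofReal_mul]
    congr 1
    rw [PoissonSmoothing.kernel]
    have hT2 : T ^ 2 + τ ^ 2 ≠ 0 := by positivity
    field_simp
  simp_rw [hker] at h
  have h2 : ∫ τ : ℝ, ((1 / (π * T) : ℝ) : ℂ) * (((1 + τ ^ 2 / T ^ 2)⁻¹ : ℝ) : ℂ) *
      Complex.exp (-((τ * v : ℝ) : ℂ) * I) =
      ((1 / (π * T) : ℝ) : ℂ) * ∫ τ : ℝ, Complex.exp (-((τ * v : ℝ) : ℂ) * I) *
        (((1 + τ ^ 2 / T ^ 2)⁻¹ : ℝ) : ℂ) := by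
    rw [← integral_const_mul]
    refine integral_congr_ae (Eventually.of_forall fun τ => ?_)
    simp only; ring
  rw [h2] at h
  set J := ∫ τ : ℝ, Complex.exp (-((τ * v : ℝ) : ℂ) * I) * (((1 + τ ^ 2 / T ^ 2)⁻¹ : ℝ) : ℂ) with hJ
  have hπT : (π * T : ℝ) * (1 / (π * T)) = 1 := by field_simp
  calc J = ((π * T : ℝ) : ℂ) * (((1 / (π * T) : ℝ) : ℂ) * J) := by
        rw [← mul_assoc, ← Complex.ofReal_mul, hπT, Complex.ofReal_one, one_mul]
    _ = ((π * T : ℝ) : ℂ) * ((Real.exp (-(T * |v|)) : ℝ) : ℂ) := by rw [h]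
    _ = ((π * T * Real.exp (-(T * |v|)) : ℝ) : ℂ) := by rw [← Complex.ofReal_mul]


/-! ### The kernel `K_T(m,n) = e^{−T|log m − log n|} = min(m/n, n/m)^T` and its row sums -/

/-- For `1 ≤ m ≤ n`: `e^{−T|log m − log n|} = (m/n)^T` (the kernel `min(m/n, n/m)^T` of (5.15)).
[cite: ConreyIwaniec2002, §5 (display after (5.13))] -/
theorem exp_neg_mul_abs_log_sub_of_le (T : ℝ) {m n : ℕ} (hm : 1 ≤ m) (hmn : m ≤ n) :
    Real.exp (-(T * |Real.log m - Real.log n|)) = ((m : ℝ) / n) ^ T := by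
  have hm0 : (0 : ℝ) < m := by exact_mod_cast hm
  have hn0 : (0 : ℝ) < n := by exact_mod_cast (lt_of_lt_of_le hm hmn)
  have hlog : Real.log m ≤ Real.log n := Real.log_le_log hm0 (by exact_mod_cast hmn)
  rw [abs_of_nonpos (by linarith), Real.rpow_def_of_pos (by positivity), Real.log_div hm0.ne' hn0.ne']
  congr 1; ring

/-- `∫_0^n (x/n)^T dx = n/(T+1)` for `T > 0`, `n > 0` (the integral behind `Σ_{m≤n}(m/n)^T`).
[cite: ConreyIwaniec2002, §5 (display before (5.15))] -/
theorem integral_div_rpow {T : ℝ} (hT : 0 < T) {n : ℝ} (hn : 0 < n) :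
    ∫ x in (0 : ℝ)..n, (x / n) ^ T = n / (T + 1) := by
  have h := intervalIntegral.integral_comp_div (f := fun x : ℝ => x ^ T) (a := 0) (b := n) hn.ne'
  rw [h, zero_div, div_self hn.ne', integral_rpow (Or.inl (by linarith))]
  rw [Real.one_rpow, Real.zero_rpow (by linarith), sub_zero, smul_eq_mul]
  ring

/-- `∫_n^M (n/x)^T dx ≤ n/(T−1)` for `T > 1`, `0 < n ≤ M` ("`1 + ∫_n^∞ (n/x)^T dx = 1 + n/(T−1)`").
[cite: ConreyIwaniec2002, §5 (display before (5.15))] -/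
theorem integral_div_rpow_le {T : ℝ} (hT : 1 < T) {n M : ℝ} (hn : 0 < n) (hnM : n ≤ M) :
    ∫ x in n..M, (n / x) ^ T ≤ n / (T - 1) := by
  have hM : 0 < M := lt_of_lt_of_le hn hnM
  have heq : ∫ x in n..M, (n / x) ^ T = n ^ T * ∫ x in n..M, x ^ (-T) := by
    rw [← intervalIntegral.integral_const_mul]
    refine intervalIntegral.integral_congr fun x hx => ?_
    rw [Set.uIcc_of_le hnM] at hx
    have hx0 : 0 < x := lt_of_lt_of_le hn hx.1
    rw [Real.div_rpow hn.le hx0.le, Real.rpow_neg hx0.le, div_eq_mul_inv]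
  have h0 : (0 : ℝ) ∉ Set.uIcc n M := by
    rw [Set.uIcc_of_le hnM]; intro h; exact absurd h.1 (not_le.mpr hn)
  rw [heq, integral_rpow (Or.inr ⟨by linarith, h0⟩)]
  have hT1 : -T + 1 ≠ 0 := by linarith
  have hnT : (n : ℝ) ^ T * n ^ (-T + 1) = n := by
    rw [← Real.rpow_add hn]; simp
  have hMT : 0 ≤ (n : ℝ) ^ T * M ^ (-T + 1) := by positivity
  rw [mul_div_assoc', mul_sub, hnT]
  have e1 : ((n : ℝ) ^ T * M ^ (-T + 1) - n) / (-T + 1) = (n - n ^ T * M ^ (-T + 1)) / (T - 1) := by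
    rw [show (-T + 1) = -(T - 1) by ring, div_neg, ← neg_div, neg_sub]
  rw [e1]
  exact div_le_div_of_nonneg_right (by linarith) (by linarith)

/-- **Row sums of the kernel**: for `T ≥ 2` and `1 ≤ n`,
`Σ_{1 ≤ m ≤ N} e^{−T|log m − log n|} ≤ 1 + 3n/T`
(`Σ_{m ≤ n}(m/n)^T ≤ 1 + ∫_0^n (x/n)^T = 1 + n/(T+1)`, `Σ_{m > n}(n/m)^T ≤ ∫_n^∞ (n/x)^T = n/(T−1)`).
[cite: ConreyIwaniec2002, §5 (display before (5.15))] -/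
theorem sum_kernel_le {T : ℝ} (hT : 2 ≤ T) (N : ℕ) {n : ℕ} (hn : 1 ≤ n) :
    ∑ m ∈ Finset.Icc 1 N, Real.exp (-(T * |Real.log m - Real.log n|)) ≤ 1 + 3 * n / T := by
  have hn0 : (0 : ℝ) < n := by exact_mod_cast hn
  have hT0 : 0 < T := by linarith
  -- split at `m ≤ n`
  rw [← Finset.sum_filter_add_sum_filter_not (Finset.Icc 1 N) (fun m => m ≤ n)]
  -- the part `m ≤ n`
  have h1 : ∑ m ∈ (Finset.Icc 1 N).filter (fun m => m ≤ n),
      Real.exp (-(T * |Real.log m - Real.log n|)) ≤ 1 + n / (T + 1) := by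
    calc ∑ m ∈ (Finset.Icc 1 N).filter (fun m => m ≤ n), Real.exp (-(T * |Real.log m - Real.log n|))
        ≤ ∑ m ∈ Finset.Icc 1 n, Real.exp (-(T * |Real.log m - Real.log n|)) := by
          refine Finset.sum_le_sum_of_subset_of_nonneg (fun m hm => ?_) fun _ _ _ => (Real.exp_pos _).le
          simp only [Finset.mem_filter, Finset.mem_Icc] at hm ⊢
          exact ⟨hm.1.1, hm.2⟩
      _ = ∑ m ∈ Finset.Icc 1 n, ((m : ℝ) / n) ^ T := by
          refine Finset.sum_congr rfl fun m hm => ?_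
          rw [Finset.mem_Icc] at hm
          exact exp_neg_mul_abs_log_sub_of_le T hm.1 hm.2
      _ ≤ 1 + ∑ m ∈ Finset.Ico 0 n, ((m : ℝ) / n) ^ T := by
          -- `Σ_{1}^{n} f(m) = f(n) + Σ_{1}^{n-1} f(m) ≤ 1 + Σ_{0}^{n-1} f(m)`
          have hsplit : Finset.Icc 1 n = insert n (Finset.Icc 1 (n - 1)) := by
            ext m; simp only [Finset.mem_insert, Finset.mem_Icc]; omega
          have hnot : n ∉ Finset.Icc 1 (n - 1) := by simp; omega
          rw [hsplit, Finset.sum_insert hnot, div_self hn0.ne', Real.one_rpow]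
          have hsub : Finset.Icc 1 (n - 1) ⊆ Finset.Ico 0 n := by
            intro m hm; simp only [Finset.mem_Icc, Finset.mem_Ico] at hm ⊢; omega
          have := Finset.sum_le_sum_of_subset_of_nonneg hsub
            (f := fun m : ℕ => ((m : ℝ) / n) ^ T) fun _ _ _ => by positivity
          linarith
      _ ≤ 1 + n / (T + 1) := by
          gcongr
          have hmono : MonotoneOn (fun x : ℝ => (x / n) ^ T) (Set.Icc ((0 : ℕ) : ℝ) ((n : ℕ) : ℝ)) := by
            intro x hx y _ hxy
            have hx0 : 0 ≤ x := by simpa using hx.1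
            exact Real.rpow_le_rpow (div_nonneg hx0 hn0.le) (div_le_div_of_nonneg_right hxy hn0.le) hT0.le
          have hint := MonotoneOn.sum_le_integral_Ico (Nat.zero_le n) hmono
          refine hint.trans (le_of_eq ?_)
          push_cast
          exact integral_div_rpow hT0 hn0
  -- the part `m > n`
  have h2 : ∑ m ∈ (Finset.Icc 1 N).filter (fun m => ¬ m ≤ n),
      Real.exp (-(T * |Real.log m - Real.log n|)) ≤ n / (T - 1) := by
    rcases le_or_gt N n with hNn | hnN
    · have : (Finset.Icc 1 N).filter (fun m => ¬ m ≤ n) = ∅ := by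
        ext m; simp only [Finset.mem_filter, Finset.mem_Icc, Finset.notMem_empty, iff_false]; omega
      rw [this, Finset.sum_empty]
      have : 0 < T - 1 := by linarith
      positivity
    have hfilt : (Finset.Icc 1 N).filter (fun m => ¬ m ≤ n) =
        (Finset.Ico n N).map (addRightEmbedding 1) := by
      rw [Finset.map_add_right_Ico]
      ext m; simp only [Finset.mem_filter, Finset.mem_Icc, Finset.mem_Ico]; omega
    rw [hfilt, Finset.sum_map]
    set f : ℝ → ℝ := fun x => ((n : ℝ) / x) ^ T with hf
    have hterm : ∀ i ∈ Finset.Ico n N,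
        Real.exp (-(T * |Real.log ((addRightEmbedding 1 i : ℕ) : ℝ) - Real.log n|)) = f ((i + 1 : ℕ) : ℝ) := by
      intro i hi
      rw [Finset.mem_Ico] at hi
      have h1 : (addRightEmbedding 1 i : ℕ) = i + 1 := rfl
      rw [h1, abs_sub_comm, exp_neg_mul_abs_log_sub_of_le T hn (by omega)]
    rw [Finset.sum_congr rfl hterm]
    have hanti : AntitoneOn f (Set.Icc (n : ℝ) (N : ℝ)) := by
      intro x hx y _ hxy
      have hx0 : 0 < x := lt_of_lt_of_le hn0 hx.1
      simp only [hf]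
      exact Real.rpow_le_rpow (div_nonneg hn0.le (hx0.le.trans hxy))
        (div_le_div_of_nonneg_left hn0.le hx0 hxy) hT0.le
    have hint := AntitoneOn.sum_le_integral_Ico hnN.le hanti
    refine hint.trans ?_
    exact integral_div_rpow_le (by linarith) hn0 (by exact_mod_cast hnN.le)
  -- combine: `1 + n/(T+1) + n/(T−1) ≤ 1 + 3n/T` for `T ≥ 2`
  have hA : (n : ℝ) / (T + 1) ≤ n / T := div_le_div_of_nonneg_left hn0.le hT0 (by linarith)
  have hB : (n : ℝ) / (T - 1) ≤ 2 * n / T := by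
    rw [div_le_div_iff₀ (by linarith) hT0]; nlinarith
  have : (n : ℝ) / T + 2 * n / T = 3 * n / T := by ring
  linarith [h1, h2]

/-! ### The Cauchy-kernel mean value (5.15) -/

/-- The Cauchy kernel `(1 + τ²/T²)^{−1}` of (5.13)–(5.15) is integrable.
[cite: ConreyIwaniec2002, §5 (5.13)] -/
theorem integrable_cauchyKernel {T : ℝ} (hT : 0 < T) :
    Integrable fun τ : ℝ => (1 + τ ^ 2 / T ^ 2)⁻¹ := by
  have h := (PoissonSmoothing.integrable_kernel hT).const_mul (π * T)
  refine h.congr (Eventually.of_forall fun τ => ?_)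
  simp only [PoissonSmoothing.kernel]
  have : T ^ 2 + τ ^ 2 ≠ 0 := by positivity
  field_simp

/-- Cauchy–Schwarz for integrals of real functions over `ℝ`:
`∫ u v ≤ (∫ u²)^{1/2} (∫ v²)^{1/2}` (discriminant of `λ ↦ ∫ (λu − v)² ≥ 0`) — "by Cauchy–Schwarz
inequality" in the proof of Lemma 5.1. [cite: ConreyIwaniec2002, Lemma 5.1 (proof)] -/
theorem integral_mul_le_sqrt_mul_sqrt {u v : ℝ → ℝ}
    (hu2 : Integrable (fun x => u x ^ 2)) (hv2 : Integrable (fun x => v x ^ 2))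
    (huv : Integrable (fun x => u x * v x)) :
    ∫ x, u x * v x ≤ Real.sqrt (∫ x, u x ^ 2) * Real.sqrt (∫ x, v x ^ 2) := by
  set A : ℝ := ∫ x, u x ^ 2 with hA
  set B : ℝ := ∫ x, u x * v x with hB
  set C : ℝ := ∫ x, v x ^ 2 with hC
  have hA0 : 0 ≤ A := integral_nonneg fun x => sq_nonneg _
  have hC0 : 0 ≤ C := integral_nonneg fun x => sq_nonneg _
  have key : ∀ l : ℝ, 0 ≤ A * l ^ 2 - 2 * B * l + C := by
    intro l
    have h0 : 0 ≤ ∫ x, (l * u x - v x) ^ 2 := integral_nonneg fun x => sq_nonneg _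
    have e : ∫ x, (l * u x - v x) ^ 2 = A * l ^ 2 - 2 * B * l + C := by
      have : (fun x => (l * u x - v x) ^ 2) =
          fun x => (l ^ 2 * u x ^ 2 - 2 * l * (u x * v x)) + v x ^ 2 := by
        funext x; ring
      have hi1 : Integrable (fun x => l ^ 2 * u x ^ 2 - 2 * l * (u x * v x)) :=
        (hu2.const_mul _).sub (huv.const_mul _)
      rw [this, integral_add hi1 hv2, integral_sub (hu2.const_mul _) (huv.const_mul _),
        integral_const_mul, integral_const_mul]
      ring
    linarith
  rcases le_or_gt B 0 with hB0 | hB0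
  · exact hB0.trans (by positivity)
  have hB2 : B ^ 2 ≤ A * C := by
    rcases hA0.eq_or_lt with hA00 | hApos
    · have h := key ((C + 1) / (2 * B))
      rw [← hA00] at h
      have : 2 * B * ((C + 1) / (2 * B)) = C + 1 := by field_simp
      nlinarith
    · have h := key (B / A)
      have e : A * (B / A) ^ 2 - 2 * B * (B / A) + C = C - B ^ 2 / A := by
        field_simp; ring
      rw [e, sub_nonneg, div_le_iff₀ hApos] at h
      linarith
  calc B = Real.sqrt (B ^ 2) := (Real.sqrt_sq hB0.le).symm
    _ ≤ Real.sqrt (A * C) := Real.sqrt_le_sqrt hB2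
    _ = Real.sqrt A * Real.sqrt C := Real.sqrt_mul hA0 C

/-- **(5.15): the mean value of a Dirichlet polynomial against the Cauchy kernel.** For `T ≥ 2`,
`∫_ℝ |Σ_{n≤N} a_n n^{−iτ}|² (1 + τ²/T²)^{−1} dτ ≤ π Σ_n (T + 3n) |a_n|²`
(`= πT Σ_{m,n} a_m ā_n min(m/n,n/m)^T ≤ πT Σ_n |a_n|² Σ_m min(m/n,n/m)^T`).
[cite: ConreyIwaniec2002, §5 (5.15)] -/
theorem integral_norm_sq_dpoly_cauchy_le (a : ℕ → ℂ) (N : ℕ) {T : ℝ} (hT : 2 ≤ T) :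
    ∫ τ : ℝ, ‖∑ n ∈ Finset.Icc 1 N, a n * (n : ℂ) ^ (-((τ : ℂ) * I))‖ ^ 2 * (1 + τ ^ 2 / T ^ 2)⁻¹ ≤
      π * ∑ n ∈ Finset.Icc 1 N, (T + 3 * n) * ‖a n‖ ^ 2 := by
  have hT0 : 0 < T := by linarith
  set D : ℝ → ℂ := fun τ => ∑ n ∈ Finset.Icc 1 N, a n * (n : ℂ) ^ (-((τ : ℂ) * I)) with hD
  set k : ℝ → ℝ := fun τ => (1 + τ ^ 2 / T ^ 2)⁻¹ with hk
  have hk0 : ∀ τ, 0 ≤ k τ := fun τ => by positivity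
  have hkint : Integrable k := integrable_cauchyKernel hT0
  -- the complex terms `c_{mn} e^{−iτ(log m − log n)} k(τ)`
  set c : ℕ → ℕ → ℂ := fun m n => a m * starRingEnd ℂ (a n) with hc
  set e : ℕ → ℕ → ℝ → ℂ := fun m n τ =>
    Complex.exp (-((τ * (Real.log m - Real.log n) : ℝ) : ℂ) * I) with he
  have hnorm_e : ∀ m n τ, ‖e m n τ‖ = 1 := fun m n τ => by
    simp only [he]
    rw [show -((τ * (Real.log m - Real.log n) : ℝ) : ℂ) * I =
      ((-(τ * (Real.log m - Real.log n)) : ℝ) : ℂ) * I by push_cast; ring]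
    exact Complex.norm_exp_ofReal_mul_I _
  have hcont_e : ∀ m n, Continuous (e m n) := fun m n => by simp only [he]; fun_prop
  have hint_term : ∀ m n, Integrable (fun τ => c m n * (e m n τ * ((k τ : ℝ) : ℂ))) := by
    intro m n
    refine Integrable.const_mul ?_ _
    refine ((hkint.ofReal (𝕜 := ℂ)).norm.mono' ((hcont_e m n).aestronglyMeasurable.mul
      (Complex.continuous_ofReal.comp_aestronglyMeasurable hkint.aestronglyMeasurable)) ?_)
    refine Eventually.of_forall fun τ => ?_
    rw [norm_mul, hnorm_e, one_mul]
    exact le_rfl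
  -- pointwise: `‖D‖² k = Re (Σ c e k)`
  have hpt : ∀ τ, ‖D τ‖ ^ 2 * k τ =
      (∑ m ∈ Finset.Icc 1 N, ∑ n ∈ Finset.Icc 1 N, c m n * (e m n τ * ((k τ : ℝ) : ℂ))).re := by
    intro τ
    rw [hD, norm_sq_dpoly_eq]
    have : (∑ m ∈ Finset.Icc 1 N, ∑ n ∈ Finset.Icc 1 N, c m n * (e m n τ * ((k τ : ℝ) : ℂ))) =
        (∑ m ∈ Finset.Icc 1 N, ∑ n ∈ Finset.Icc 1 N, a m * starRingEnd ℂ (a n) * e m n τ) *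
          ((k τ : ℝ) : ℂ) := by
      rw [Finset.sum_mul]
      refine Finset.sum_congr rfl fun m _ => ?_
      rw [Finset.sum_mul]
      refine Finset.sum_congr rfl fun n _ => ?_
      simp only [hc]; ring
    rw [this, Complex.re_mul_ofReal]
  -- integrate: `∫ Re Σ = Re Σ c ∫ e k = Re Σ c · πT K`
  have hI : ∫ τ : ℝ, ‖D τ‖ ^ 2 * k τ =
      (∑ m ∈ Finset.Icc 1 N, ∑ n ∈ Finset.Icc 1 N,
        c m n * ((π * T * Real.exp (-(T * |Real.log m - Real.log n|)) : ℝ) : ℂ)).re := by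
    simp_rw [hpt]
    have hsum_int : Integrable (fun τ => ∑ m ∈ Finset.Icc 1 N, ∑ n ∈ Finset.Icc 1 N,
        c m n * (e m n τ * ((k τ : ℝ) : ℂ))) :=
      integrable_finsetSum _ fun m _ => integrable_finsetSum _ fun n _ => hint_term m n
    have hre := integral_re hsum_int
    simp only [RCLike.re_to_complex] at hre
    rw [hre]
    congr 1
    rw [integral_finsetSum _ fun m _ => integrable_finsetSum _ fun n _ => hint_term m n]
    refine Finset.sum_congr rfl fun m _ => ?_
    rw [integral_finsetSum _ fun n _ => hint_term m n]
    refine Finset.sum_congr rfl fun n _ => ?_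
    rw [integral_const_mul]
    congr 1
    have := integral_exp_mul_cauchy hT0 (Real.log m - Real.log n)
    simp only [he, hk]
    rw [← this]
  rw [hI, Complex.re_sum]
  simp_rw [Complex.re_sum]
  -- bound each term: `Re(c_{mn} K) ≤ |a_m||a_n| K ≤ (|a_m|²+|a_n|²)/2 · K`
  set Kf : ℕ → ℕ → ℝ := fun m n => Real.exp (-(T * |Real.log m - Real.log n|)) with hKf
  have hK0 : ∀ m n, 0 ≤ Kf m n := fun m n => (Real.exp_pos _).le
  have hKsymm : ∀ m n, Kf m n = Kf n m := fun m n => by simp only [hKf, abs_sub_comm]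
  have hterm : ∀ m n, (c m n * ((π * T * Kf m n : ℝ) : ℂ)).re ≤
      π * T * ((‖a m‖ ^ 2 + ‖a n‖ ^ 2) / 2 * Kf m n) := by
    intro m n
    calc (c m n * ((π * T * Kf m n : ℝ) : ℂ)).re ≤ ‖c m n * ((π * T * Kf m n : ℝ) : ℂ)‖ := Complex.re_le_norm _
      _ = ‖a m‖ * ‖a n‖ * (π * T * Kf m n) := by
          rw [norm_mul, Complex.norm_real, Real.norm_of_nonneg (by positivity)]
          simp only [hc, norm_mul, Complex.norm_conj]
      _ ≤ (‖a m‖ ^ 2 + ‖a n‖ ^ 2) / 2 * (π * T * Kf m n) := by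
          gcongr
          nlinarith [sq_nonneg (‖a m‖ - ‖a n‖)]
      _ = π * T * ((‖a m‖ ^ 2 + ‖a n‖ ^ 2) / 2 * Kf m n) := by ring
  calc ∑ m ∈ Finset.Icc 1 N, ∑ n ∈ Finset.Icc 1 N, (c m n * ((π * T * Kf m n : ℝ) : ℂ)).re
      ≤ ∑ m ∈ Finset.Icc 1 N, ∑ n ∈ Finset.Icc 1 N, π * T * ((‖a m‖ ^ 2 + ‖a n‖ ^ 2) / 2 * Kf m n) :=
        Finset.sum_le_sum fun m _ => Finset.sum_le_sum fun n _ => hterm m n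
    _ = π * T * ∑ n ∈ Finset.Icc 1 N, ‖a n‖ ^ 2 * ∑ m ∈ Finset.Icc 1 N, Kf m n := by
        have hin : ∀ m ∈ Finset.Icc 1 N, ∑ n ∈ Finset.Icc 1 N, π * T * ((‖a m‖ ^ 2 + ‖a n‖ ^ 2) / 2 * Kf m n)
            = π * T * ∑ n ∈ Finset.Icc 1 N, (‖a m‖ ^ 2 + ‖a n‖ ^ 2) / 2 * Kf m n :=
          fun m _ => by rw [Finset.mul_sum]
        rw [Finset.sum_congr rfl hin, ← Finset.mul_sum]
        congr 1
        -- symmetrise: `Σ_m Σ_n (A_m + A_n)/2 K_{mn} = Σ_n A_n Σ_m K_{mn}` using `K_{mn} = K_{nm}`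
        have hP : ∑ m ∈ Finset.Icc 1 N, ∑ n ∈ Finset.Icc 1 N, ‖a m‖ ^ 2 / 2 * Kf m n =
            ∑ n ∈ Finset.Icc 1 N, ‖a n‖ ^ 2 / 2 * ∑ m ∈ Finset.Icc 1 N, Kf m n := by
          refine Finset.sum_congr rfl fun m _ => ?_
          rw [Finset.mul_sum]
          exact Finset.sum_congr rfl fun n _ => by rw [hKsymm]
        have hQ : ∑ m ∈ Finset.Icc 1 N, ∑ n ∈ Finset.Icc 1 N, ‖a n‖ ^ 2 / 2 * Kf m n =
            ∑ n ∈ Finset.Icc 1 N, ‖a n‖ ^ 2 / 2 * ∑ m ∈ Finset.Icc 1 N, Kf m n := by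
          rw [Finset.sum_comm]
          exact Finset.sum_congr rfl fun n _ => by rw [Finset.mul_sum]
        have hsplit : ∀ m n, (‖a m‖ ^ 2 + ‖a n‖ ^ 2) / 2 * Kf m n =
            ‖a m‖ ^ 2 / 2 * Kf m n + ‖a n‖ ^ 2 / 2 * Kf m n := fun m n => by ring
        simp_rw [hsplit, Finset.sum_add_distrib, hP, hQ, ← Finset.sum_add_distrib]
        exact Finset.sum_congr rfl fun n _ => by ring
    _ ≤ π * T * ∑ n ∈ Finset.Icc 1 N, ‖a n‖ ^ 2 * (1 + 3 * n / T) := by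
        gcongr with n hn
        rw [Finset.mem_Icc] at hn
        exact sum_kernel_le hT N hn.1
    _ = π * ∑ n ∈ Finset.Icc 1 N, (T + 3 * n) * ‖a n‖ ^ 2 := by
        rw [Finset.mul_sum, Finset.mul_sum]
        refine Finset.sum_congr rfl fun n _ => ?_
        field_simp

end WeightedMeanValue

end Literature.NumberTheory.LFunctions

end
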